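import Summits.MatrixMultiplication.MatrixMultiplication.Theorems.FarEdgeDescentStratumTightConcise
import Summits.MatrixMultiplication.MatrixMultiplication.Theorems.FarEdgeDescentCouplingBridge
import Summits.MatrixMultiplication.MatrixMultiplication.Theorems.OutsiderSandwichBlockOneOperational
import HarnessLib

/-!
# The transposed star has a door too: `R̃(𝔖^ᵀ) = R̃(C₁)`, so `R̃(𝔖^ᵀ) ≤ 4 ⟹ ω = 2`, and the twin question for `𝔖^ᵀ` is lens-4's `BlockBelowMM`

Route `FarEdgeDescent` (cell `decomp-mm`, lens 2 «structural dichotomy (special vs generic)»,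
gen 33), Kernel VIII-e; support for the aside `SubLogRate` (stmt-MatrixMultiplication-25371).

Kernels VIII-a–d treated the weighted stars `𝔖^w` (support of `⟨2,2,2⟩`: s-rank door, `Q̃ = 4` pin,
tight + concise, ARC consumer). The route's own generic class — the TRANSPOSED star
`𝔖^ᵀ = twistedStar ℂ 2 1 = weightedTStar 1`, `(X; y, y') ↦ (Xy, Xᵀy')` — does not carry the support of
`⟨2,2,2⟩`, so the Cohn–Umans door does not apply to it. But the tree already knows (lens 2, gen 29,
`FarEdgeDescentCouplingBridge`) that lens-4's coupled Coppersmith–Winograd block `C₁` IS `𝔖^ᵀ` with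
the legs rotated, as mutual restrictions, and (lens 4, `OutsiderSandwichCouplingBenchmark`,
`OutsiderSandwichBlockOneOperational`) that `R̃(C₁) ≤ 4 ⟹ ω = 2`, `R̃(C₁) ≤ 6`, and
`R̃(C₁) = 4 ⟺ (ω = 2 ∧ BlockBelowMM)`. Transporting along the rotation (`R̃` is rotation invariant,
universal spectral points agree on mutually restricting tensors):

* `asymptoticRank_twistedStar_eq_coupling₁` — **`R̃(𝔖^ᵀ) = R̃(C₁)`**; hence `R̃(𝔖^ᵀ) ∈ [4, 6]`;
* `summit_of_asymptoticRank_twistedStar_le_four` — **the door for the `ᵀ` class: `R̃(𝔖^ᵀ) ≤ 4 ⟹ ω = 2`**;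
* `twistedStar_flat_iff_summit_and_twin` — `R̃(𝔖^ᵀ) = 4 ⟺ (ω = 2 ∧ 𝔖^ᵀ` is a spectral twin of `⟨2,2,2⟩)`;
* `twistedStar_flat_iff_summit_and_blockBelowMM`, `twin_iff_blockBelowMM_of_summit` — the cell's
  twin question for `𝔖^ᵀ` («ᵀ ~ ⟨2,2,2⟩?», ASK I-g32a (2)) is, under `ω = 2`, exactly lens-4's ω-free
  aside `BlockBelowMM` (`C₁ ≲ ⟨2,2,2⟩` spectrally);
* `asymptoticRank_coupling₁_of_arc`, `blockBelowMM_of_arc` — **Strassen's asymptotic rank conjecture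
  (CGLVW Conj. 1.4, tight form) proves lens-4's single-tensor hypothesis `R̃(C₁) = 4` and its aside
  `BlockBelowMM`** (through the explicit tight concise cubic copy of `𝔖^ᵀ`, Kernel VIII-c).

References: D. Coppersmith, S. Winograd, J. Symb. Comp. 9 (1990), §7 [CoppersmithWinograd1990];
H. Cohn, C. Umans, SODA 2013, §3 [CohnUmans2013]; A. Conner, F. Gesmundo, J.M. Landsberg, E. Ventura,
Y. Wang, Collect. Math. 72 (2021), Conj. 1.4 [ConnerGesmundoLandsbergVenturaWang2020]; M. Christandl,
P. Vrana, J. Zuiddam, J. AMS 36 (2023), Prop. 1.6 [ChristandlVranaZuiddam2023]; M. Bläser, *Fast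
Matrix Multiplication* (2013), §5.1 [Blaser2013].
-/

noncomputable section

open scoped BigOperators

set_option linter.dupNamespace false

namespace Summit.MatrixMultiplication.MatrixMultiplication.Theorems.FarEdgeDescentStratumPinning

open Literature.Computability.AlgebraicComplexity
open Summit.MatrixMultiplication.MatrixMultiplication.Theorems.FarEdgeDescentTwistedStar (twistedStar)
open Summit.MatrixMultiplication.MatrixMultiplication.Theorems.FarEdgeDescentSignTwist
open Summit.MatrixMultiplication.MatrixMultiplication.Theorems.FarEdgeDescentSignStarSRank
open Summit.MatrixMultiplication.MatrixMultiplication.Theorems.OutsiderSandwichCoupling (coupling₁)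
open Summit.MatrixMultiplication.MatrixMultiplication.Theorems.FarEdgeDescentCouplingBridge
  (map_coupling₁_eq_map_rotate_twistedStar)
open Summit.MatrixMultiplication.MatrixMultiplication.Theorems.OutsiderSandwichLaserBridge
  (asymptoticRank_rotate)

/-! ## 1. `R̃(𝔖^ᵀ) = R̃(C₁)` -/

section Transport

/-- `R̃(rotate 𝔖^ᵀ) = R̃(C₁)`: every universal spectral point agrees on the two (mutual restrictions,
`map_coupling₁_eq_map_rotate_twistedStar`) and `R̃ = max` over the spectrum. [cite: ChristandlVranaZuiddam2023, Prop. 1.6] -/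
theorem asymptoticRank_rotate_twistedStar_eq_coupling₁ :
    asymptoticRank (rotate (twistedStar ℂ 2 1)) = asymptoticRank coupling₁ := by
  refine le_antisymm ?_ ?_
  · obtain ⟨F, hF, hFt⟩ := (strassen_duality_asymptoticRank_holds ℂ (rotate (twistedStar ℂ 2 1))).2
    rw [← hFt, ← map_coupling₁_eq_map_rotate_twistedStar hF]
    exact (strassen_duality_asymptoticRank_holds ℂ coupling₁).1 F hF
  · obtain ⟨F, hF, hFt⟩ := (strassen_duality_asymptoticRank_holds ℂ coupling₁).2
    rw [← hFt, map_coupling₁_eq_map_rotate_twistedStar hF]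
    exact (strassen_duality_asymptoticRank_holds ℂ (rotate (twistedStar ℂ 2 1))).1 F hF

/-- **`R̃(𝔖^ᵀ) = R̃(C₁)`**: the route's transposed star and lens-4's coupled CW block have the same
asymptotic rank (`R̃` is rotation invariant). [cite: Blaser2013, §5.1 (permutation of tensors)] -/
theorem asymptoticRank_twistedStar_eq_coupling₁ :
    asymptoticRank (twistedStar ℂ 2 1) = asymptoticRank coupling₁ := by
  rw [← asymptoticRank_rotate (twistedStar ℂ 2 1)]
  exact asymptoticRank_rotate_twistedStar_eq_coupling₁

/-- The same for the `weightedTStar 1` spelling of `𝔖^ᵀ`. [cite: Blaser2013, §5.1 (permutation of tensors)] -/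
theorem asymptoticRank_weightedTStar_one_eq_coupling₁ :
    asymptoticRank (weightedTStar ℂ 2 1 (fun _ => 1)) = asymptoticRank coupling₁ := by
  rw [weightedTStar_one]
  exact asymptoticRank_twistedStar_eq_coupling₁

/-- **`R̃(𝔖^ᵀ) ≤ 6`** (lens 4: `R̃(C₁) ≤ R̲(C₁) = 6`). [cite: BurgisserClausenShokrollahi1997, Lemma (15.27)] -/
theorem asymptoticRank_twistedStar_le_six : asymptoticRank (twistedStar ℂ 2 1) ≤ 6 := by
  rw [asymptoticRank_twistedStar_eq_coupling₁]
  exact OutsiderSandwichBlockOneOperational.asymptoticRank_coupling₁_le_six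

/-- `R̃(𝔖^ᵀ) ∈ [4, 6]`. [cite: BurgisserClausenShokrollahi1997, Lemma (15.27)] -/
theorem asymptoticRank_twistedStar_mem_Icc : asymptoticRank (twistedStar ℂ 2 1) ∈ Set.Icc (4 : ℝ) 6 := by
  rw [asymptoticRank_twistedStar_eq_coupling₁]
  exact OutsiderSandwichBlockOneOperational.asymptoticRank_coupling₁_mem_Icc

end Transport

/-! ## 2. The door for the `ᵀ` class -/

section Door

/-- **`R̃(𝔖^ᵀ) ≤ 4 ⟹ ω = 2`**: Strassen's conjecture for the single transposed star decides the summit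
(lens-4's door for `C₁`, transported). [cite: CoppersmithWinograd1990, §7] -/
theorem summit_of_asymptoticRank_twistedStar_le_four (h : asymptoticRank (twistedStar ℂ 2 1) ≤ 4) :
    _root_.MatrixMultiplication :=
  OutsiderSandwichCouplingBenchmark.summit_of_asymptoticRank_coupling₁_le_four
    (asymptoticRank_twistedStar_eq_coupling₁ ▸ h)

/-- Contrapositive: `ω > 2 ⟹ R̃(𝔖^ᵀ) > 4`. [cite: CoppersmithWinograd1990, §7] -/
theorem four_lt_asymptoticRank_twistedStar_of_not_summit (hS : ¬ _root_.MatrixMultiplication) :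
    4 < asymptoticRank (twistedStar ℂ 2 1) :=
  lt_of_not_ge fun h => hS (summit_of_asymptoticRank_twistedStar_le_four h)

/-- **`R̃(𝔖^ᵀ) = 4 ⟺ (ω = 2 ∧ 𝔖^ᵀ` is a spectral twin of `⟨2,2,2⟩)`** (`⟹`: the door, then Kernel VIII-b
under `ω = 2`; `⟸`: Kernel VIII-b). [cite: ChristandlVranaZuiddam2023, Prop. 1.6] -/
theorem twistedStar_flat_iff_summit_and_twin :
    asymptoticRank (twistedStar ℂ 2 1) = 4 ↔
      (_root_.MatrixMultiplication ∧
        ∀ F, IsUniversalSpectralPoint ℂ F → F (twistedStar ℂ 2 1) = F (matMulTensor ℂ 2 2 2)) := by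
  have hfloor : ∀ F, IsUniversalSpectralPoint ℂ F → (4 : ℝ) ≤ F (twistedStar ℂ 2 1) := fun F hF => by
    rw [← weightedTStar_one]
    exact four_le_spectralPoint_weightedTStar (fun _ => one_ne_zero) hF
  constructor
  · intro h
    have hS := summit_of_asymptoticRank_twistedStar_le_four h.le
    exact ⟨hS, (twin_iff_flat_of_summit hS _ hfloor).2 h⟩
  · rintro ⟨hS, htwin⟩
    exact (twin_iff_flat_of_summit hS _ hfloor).1 htwin

/-- **`R̃(𝔖^ᵀ) = 4 ⟺ (ω = 2 ∧ BlockBelowMM)`** (lens-4's one-tensor criterion, read on `𝔖^ᵀ`).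
[cite: CoppersmithWinograd1990, §7] -/
theorem twistedStar_flat_iff_summit_and_blockBelowMM :
    asymptoticRank (twistedStar ℂ 2 1) = 4 ↔
      (_root_.MatrixMultiplication ∧ Theses.OutsiderSandwich.BlockBelowMM) := by
  rw [asymptoticRank_twistedStar_eq_coupling₁]
  exact OutsiderSandwichBlockOneOperational.asymptoticRank_coupling₁_eq_four_iff

/-- **Under `ω = 2` the twin question for `𝔖^ᵀ` IS lens-4's aside**: `𝔖^ᵀ` is a spectral twin of
`⟨2,2,2⟩` iff `BlockBelowMM` (`C₁ ≲ ⟨2,2,2⟩` at every universal spectral point). [cite: ChristandlVranaZuiddam2023, Prop. 1.6] -/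
theorem twin_iff_blockBelowMM_of_summit (hS : _root_.MatrixMultiplication) :
    (∀ F, IsUniversalSpectralPoint ℂ F → F (twistedStar ℂ 2 1) = F (matMulTensor ℂ 2 2 2)) ↔
      Theses.OutsiderSandwich.BlockBelowMM := by
  constructor
  · intro htwin
    exact ((twistedStar_flat_iff_summit_and_blockBelowMM).1
      ((twistedStar_flat_iff_summit_and_twin).2 ⟨hS, htwin⟩)).2
  · intro hB
    exact ((twistedStar_flat_iff_summit_and_twin).1
      ((twistedStar_flat_iff_summit_and_blockBelowMM).2 ⟨hS, hB⟩)).2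

/-- Unconditionally: (`ω = 2 ∧` twin of `𝔖^ᵀ`) `⟺` (`ω = 2 ∧ BlockBelowMM`). [cite: ChristandlVranaZuiddam2023, Prop. 1.6] -/
theorem summit_and_twin_iff_summit_and_blockBelowMM :
    (_root_.MatrixMultiplication ∧
        ∀ F, IsUniversalSpectralPoint ℂ F → F (twistedStar ℂ 2 1) = F (matMulTensor ℂ 2 2 2)) ↔
      (_root_.MatrixMultiplication ∧ Theses.OutsiderSandwich.BlockBelowMM) := by
  rw [← twistedStar_flat_iff_summit_and_twin, twistedStar_flat_iff_summit_and_blockBelowMM]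

end Door

/-! ## 3. What Strassen's asymptotic rank conjecture gives lens 4 -/

section ARC

/-- **ARC ⟹ `R̃(C₁) = 4`**: the tight form of the asymptotic rank conjecture (CGLVW Conj. 1.4) proves
lens-4's single-tensor hypothesis, through the tight concise cubic copy of `𝔖^ᵀ`. [cite: ConnerGesmundoLandsbergVenturaWang2020, Conj. 1.4] -/
theorem asymptoticRank_coupling₁_of_arc (hARC : StrassenAsymptoticRankConjecture) :
    asymptoticRank coupling₁ = 4 := by
  rw [← asymptoticRank_twistedStar_eq_coupling₁]
  exact asymptoticRank_twistedStar_of_arc hARC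

/-- **ARC ⟹ `BlockBelowMM`** (lens-4's ω-free aside). [cite: ConnerGesmundoLandsbergVenturaWang2020, Conj. 1.4] -/
theorem blockBelowMM_of_arc (hARC : StrassenAsymptoticRankConjecture) :
    Theses.OutsiderSandwich.BlockBelowMM :=
  (OutsiderSandwichBlockOneOperational.asymptoticRank_coupling₁_eq_four_iff.1
    (asymptoticRank_coupling₁_of_arc hARC)).2

/-- `¬ BlockBelowMM` refutes ARC (an explicit tight concise `4 × 4 × 4` tensor with `R̃ > 4`). [cite: ConnerGesmundoLandsbergVenturaWang2020, Conj. 1.4] -/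
theorem not_arc_of_not_blockBelowMM (h : ¬ Theses.OutsiderSandwich.BlockBelowMM) :
    ¬ StrassenAsymptoticRankConjecture :=
  fun hARC => h (blockBelowMM_of_arc hARC)

end ARC

end Summit.MatrixMultiplication.MatrixMultiplication.Theorems.FarEdgeDescentStratumPinning

end
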